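import Mathlib
import Literature.Computability.AlgebraicComplexity.LRPencilOfMatrix
import Literature.Computability.AlgebraicComplexity.LandsbergRessayreNormalForm
import Literature.Computability.AlgebraicComplexity.DetReprEquivalent
import Literature.Computability.AlgebraicComplexity.GenericTorusGrading
import Summits.ValiantsHypothesis.ValiantsHypothesis.Theorems.FreeSubtorusOrbitDimensionBoundStubEigenGauge
import Summits.ValiantsHypothesis.ValiantsHypothesis.Theorems.FreeSubtorusOrbitDimensionBoundStubDegMap

/-!
# Crux `FreeSubtorus.OrbitDimensionBound` (stmt-ValiantsHypothesis-16133), line `Sketch` —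
# stub `stub_homothetyGraded`: one exact lift of the homothety `x ↦ 2x` grades the pencil

Setting: an affine determinantal representation `B` of `per_n` of size `m` over `ℂ` together with
exact `GL_m × GL_m` lifts of all homotheties `x ↦ c · x` (`B(c x) = g B(x) h⁻¹`).  Conclusion: a
gauge-equivalent representation `B' = g' B h'⁻¹` (again an affine determinantal representation of
`per_n`) and integer potentials `a` (rows), `b` (columns) such that `B'` has a constant at `(i, j)`
only if `a i + b j = 0` and a variable at `(i, j)` only if `a i + b j = 1` — the pencil is GRADED BY
DEGREE.

Proof.  (1) Take ONE lift `(g, h)` of the homothety `c = 2` (the scalar matrix `2 · 1 ∈ GL(n²)`).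
(2) Comparing constant parts (`constPart_linSubstEntries`, `constPart_mul`, `constPart_map_C`, i.e.
the tree's `mul_constPart_eq_of_linSubstEntries_eq`) gives `g B₀ = B₀ h`; comparing the coefficient
matrices of the variables (`LRPencil.coeffMat_linSubstEntries`, `LRPencil.coeffMat_C_mul_mul_C`)
gives `g B_v = 2 B_v h`.  (3) The eigen-gauge `stub_eigenGauge m g h` supplies `g', h'` with
`det g' = det h'` and non-zero labels `lam, mu` such that `g' X h'⁻¹` is supported on
`lam i = c · mu j` whenever `g X = c X h`; put `B' := g' B h'⁻¹`: its entries stay affine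
(`totalDegree_map_C_mul_mul_map_C_le`), its determinant is `det g' · det h'⁻¹ · per_n = per_n`
(`det_map_C_mul_mul_map_C`), its constant part `g' B₀ h'⁻¹` is supported on `lam i = mu j` and its
coefficient matrices `g' B_v h'⁻¹` on `lam i = 2 · mu j`.  (4) The degree of a non-zero complex
number with respect to the prime `2` (tree `TorusGrading.deg` for the one-element family `p = (2)`,
`TorusGrading.deg_mul_prime`: `deg (2 z) = deg z + 1` for `z ≠ 0`) gives `d : ℂ → ℤ` with
`d (2 z) = d z + 1`; set `a i := d (lam i)`, `b j := -d (mu j)`.  Pure linear algebra. [folklore]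

Helper file for the crux (`--supports`); it closes nothing by itself.  Deliberately NOT here: the
neighbouring stubs of the line (`stub_gradedElimination`, `stub_partialPermDiag`,
`stub_layerDecomposition`).
-/

-- Sub = Summit single-conjunct layout: the duplicated namespace component is mandated by the tree.
set_option linter.dupNamespace false

noncomputable section

namespace Summit.ValiantsHypothesis.ValiantsHypothesis.Theorems.FreeSubtorusOrbitDimensionBound

open Matrix MvPolynomial
open Literature.Computability.AlgebraicComplexity
open Literature.Computability.AlgebraicComplexity.TorusGrading

/-- **A degree map for the prime `2`.**  There is `d : ℂ → ℤ` with `d (2 z) = d z + 1` for every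
`z ≠ 0` (the `2`-adic degree of `z` relative to a chosen representative of its class modulo `2^ℤ`;
the tree's `TorusGrading.deg` for the one-element prime family `(2)`). [folklore] -/
theorem exists_degMap_two : ∃ d : ℂ → ℤ, ∀ z : ℂ, z ≠ 0 → d (2 * z) = d z + 1 := by
  refine ⟨fun z => deg (fun _ : Fin 1 => 2) z 0, fun z hz => ?_⟩
  have key := deg_mul_prime (p := fun _ : Fin 1 => 2) (fun _ => Nat.prime_two)
    (Function.injective_of_subsingleton _) hz 0
  simp only [Nat.cast_ofNat] at key
  show deg (fun _ : Fin 1 => 2) (2 * z) 0 = deg (fun _ : Fin 1 => 2) z 0 + 1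
  rw [mul_comm, key, Pi.add_apply, Pi.single_eq_same]

/-- **Registered stub `stub_homothetyGraded`** (reshape 6).  Exact `GL_m × GL_m` lifts of all
homotheties `x ↦ c x` on an affine determinantal representation `B` of `per_n` yield a representation
`B'` of the same size that is GRADED BY DEGREE: integer potentials `a` (rows), `b` (columns) with a
constant at `(i,j)` only if `a i + b j = 0` and a variable only if `a i + b j = 1`.  Proof: one lift
`(g, h)` of `c = 2` gives `g B₀ = B₀ h`, `g B_v = 2 B_v h` (`constPart_linSubstEntries`,
`coeffMat_linSubstEntries`); `stub_eigenGauge` gauges to supports `lam i = mu j` (constants),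
`lam i = 2 mu j` (variables); the `2`-adic degree `d` (`exists_degMap_two`) gives `d (2 z) = d z + 1`,
and `a i = d (lam i)`, `b j = -d (mu j)`. [folklore] -/
theorem stub_homothetyGraded :
    ∀ (n m : ℕ) (B : Matrix (Fin m) (Fin m) (MvPolynomial (Fin n × Fin n) ℂ)),
      Literature.Computability.AlgebraicComplexity.IsAffineDetRepr
        (Literature.Computability.AlgebraicComplexity.perPoly (Fin n) ℂ) B →
      (∀ (c : ℂˣ) (γ : GL (Fin n × Fin n) ℂ),
        (γ : Matrix (Fin n × Fin n) (Fin n × Fin n) ℂ) = Matrix.diagonal (fun _ => (c : ℂ)) →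
        ∃ g h : GL (Fin m) ℂ,
          Literature.Computability.AlgebraicComplexity.Matrix.linSubstEntries γ B =
            (g : Matrix (Fin m) (Fin m) ℂ).map MvPolynomial.C * B *
              ((h⁻¹ : GL (Fin m) ℂ) : Matrix (Fin m) (Fin m) ℂ).map MvPolynomial.C) →
      ∃ (B' : Matrix (Fin m) (Fin m) (MvPolynomial (Fin n × Fin n) ℂ)) (a b : Fin m → ℤ),
        Literature.Computability.AlgebraicComplexity.IsAffineDetRepr
          (Literature.Computability.AlgebraicComplexity.perPoly (Fin n) ℂ) B' ∧
        (∀ i j, Literature.Computability.AlgebraicComplexity.constPart B' i j ≠ 0 → a i + b j = 0) ∧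
        (∀ i j (v : Fin n × Fin n),
          Literature.Computability.AlgebraicComplexity.LRPencil.coeffMat B' v i j ≠ 0 →
          a i + b j = 1) := by
  intro n m B hB hlift
  -- (1) the homothety `x ↦ 2x` as an element of `GL(n²)`, and one exact lift `(g, h)` of it
  let γ : GL (Fin n × Fin n) ℂ :=
    ⟨Matrix.diagonal fun _ => (2 : ℂ), Matrix.diagonal fun _ => (2 : ℂ)⁻¹, by
      rw [Matrix.diagonal_mul_diagonal, ← Matrix.diagonal_one]
      congr 1; funext; norm_num, by
      rw [Matrix.diagonal_mul_diagonal, ← Matrix.diagonal_one]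
      congr 1; funext; norm_num⟩
  have hγ : (γ : Matrix (Fin n × Fin n) (Fin n × Fin n) ℂ) = Matrix.diagonal fun _ => (2 : ℂ) := rfl
  obtain ⟨g, h, hgh⟩ := hlift (Units.mk0 (2 : ℂ) two_ne_zero) γ hγ
  -- (2) constant parts: `g B₀ = B₀ h`; coefficient matrices: `g B_v = (2 B_v) h`
  have hX0 : (g : Matrix (Fin m) (Fin m) ℂ) * constPart B =
      ((1 : ℂ) • constPart B) * (h : Matrix (Fin m) (Fin m) ℂ) := by
    rw [one_smul]; exact mul_constPart_eq_of_linSubstEntries_eq hgh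
  have hhinv :
      ((h⁻¹ : GL (Fin m) ℂ) : Matrix (Fin m) (Fin m) ℂ) * (h : Matrix (Fin m) (Fin m) ℂ) = 1 := by
    rw [← Units.val_mul, inv_mul_cancel, Units.val_one]
  have hXv : ∀ v, (g : Matrix (Fin m) (Fin m) ℂ) * LRPencil.coeffMat B v =
      ((2 : ℂ) • LRPencil.coeffMat B v) * (h : Matrix (Fin m) (Fin m) ℂ) := by
    intro v
    have h1 := congrArg (fun M => LRPencil.coeffMat M v) hgh
    rw [LRPencil.coeffMat_linSubstEntries γ B hB.1 v, LRPencil.coeffMat_C_mul_mul_C, hγ,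
      Finset.sum_eq_single v
        (fun i _ hi => by rw [Matrix.diagonal_apply_ne _ (Ne.symm hi), zero_smul])
        (fun hv => absurd (Finset.mem_univ v) hv), Matrix.diagonal_apply_eq] at h1
    -- `h1 : 2 • B_v = g B_v h⁻¹`
    calc (g : Matrix (Fin m) (Fin m) ℂ) * LRPencil.coeffMat B v
        = (g : Matrix (Fin m) (Fin m) ℂ) * LRPencil.coeffMat B v *
            (((h⁻¹ : GL (Fin m) ℂ) : Matrix (Fin m) (Fin m) ℂ) * (h : Matrix (Fin m) (Fin m) ℂ)) := by
          rw [hhinv, Matrix.mul_one]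
      _ = ((2 : ℂ) • LRPencil.coeffMat B v) * (h : Matrix (Fin m) (Fin m) ℂ) := by
          rw [← Matrix.mul_assoc, ← h1]
  -- (3) the eigen-gauge `(g', h')` with labels `lam, mu`
  obtain ⟨g', h', lam, mu, hdet, -, hmu, hsupp⟩ := stub_eigenGauge m g h
  -- (4) the `2`-adic degree
  obtain ⟨d, hd⟩ := exists_degMap_two
  refine ⟨(g' : Matrix (Fin m) (Fin m) ℂ).map C * B *
      ((h'⁻¹ : GL (Fin m) ℂ) : Matrix (Fin m) (Fin m) ℂ).map C,
    fun i => d (lam i), fun j => -d (mu j), ⟨totalDegree_map_C_mul_mul_map_C_le _ _ hB.1, ?_⟩,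
    fun i j hij => ?_, fun i j v hij => ?_⟩
  · -- `det (g' B h'⁻¹) = det g' · det h'⁻¹ · per_n = per_n`
    have h1 : (g' : Matrix (Fin m) (Fin m) ℂ).det *
        ((h'⁻¹ : GL (Fin m) ℂ) : Matrix (Fin m) (Fin m) ℂ).det = 1 := by
      rw [hdet, ← Matrix.det_mul, ← Units.val_mul, mul_inv_cancel, Units.val_one, Matrix.det_one]
    rw [det_map_C_mul_mul_map_C, h1, C_1, one_mul, hB.2]
  · -- constants: `g' B₀ h'⁻¹` is supported on `lam i = mu j`
    rw [constPart_mul, constPart_mul, constPart_map_C, constPart_map_C] at hij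
    have hl : lam i = mu j := by rw [hsupp 1 (constPart B) hX0 i j hij, one_mul]
    show d (lam i) + -d (mu j) = 0
    rw [hl, add_neg_cancel]
  · -- variables: `g' B_v h'⁻¹` is supported on `lam i = 2 · mu j`
    rw [LRPencil.coeffMat_C_mul_mul_C] at hij
    have hl : lam i = 2 * mu j := hsupp 2 (LRPencil.coeffMat B v) (hXv v) i j hij
    show d (lam i) + -d (mu j) = 1
    rw [hl, hd (mu j) (hmu j)]
    abel

end Summit.ValiantsHypothesis.ValiantsHypothesis.Theorems.FreeSubtorusOrbitDimensionBound

end
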